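import Mathlib
import HarnessLib
import Literature.Barriers.MatrixMultiplication.RectangularBarrier
import Literature.Computability.AlgebraicComplexity.AsymptoticSpectrumDuality
import Literature.Computability.AlgebraicComplexity.AsymptoticRankMatMul
import Literature.Computability.AlgebraicComplexity.DegenerationSpectralMonotone
import Literature.Computability.AlgebraicComplexity.AsymptoticSpectrumProofs
import Literature.Computability.AlgebraicComplexity.MatMulMonomialSubrankAsymptotics
import Summits.MatrixMultiplication.MatrixMultiplication.Theses.OutsiderSandwich
import Summits.MatrixMultiplication.MatrixMultiplication.Theorems.OutsiderSandwichPackingProfileLaser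

/-!
# OutsiderSandwich — the LASER FLOOR on the asymptotic spectrum, part 1/3 (decomp-mm lens-4, gen 11)

THIS FILE: §1 the matrix exponent `τ_F` of a universal spectral point, §2 the floor (route item
`LaserFloor`, 33322, by `laserFloor_holds`).  Part 2
(`OutsiderSandwichLaserFloorCut`) transports the cut of record; part 3 (`OutsiderSandwichLaserFloorTop`)
gives the ω-free letter `LaserTightAtTop` and the route items 33325/33326 by name.  Overview of all three:

Lens «minimal counterexample / extremal reduction», made literal on Strassen's asymptotic
spectrum `Δ(ℂ)`.  A counterexample to `ω = 2` *is* a universal spectral point `F ∈ Δ(ℂ)` whose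
**matrix exponent** `τ_F := log₂ F(⟨2,2,2⟩)` (`F(⟨m,m,m⟩) ≥ m^{τ_F}`, `2 ≤ τ_F ≤ ω`,
`max_F τ_F = ω` by Strassen duality with attainment; Alman–Li Prop. 4.2 writes `τ_F = θ₁+θ₂+θ₃`)
exceeds `2`.  The extremal reduction puts every
such point against ONE ω-free inequality, the

**LASER FLOOR** (proved here, ω-free):  `log₂ F(cw₂) ≥ log₂ 3 + (τ_F − 2)/3` for every `F ∈ Δ(ℂ)`,

i.e. `F(cw₂) ≥ Λ(τ_F) := 3 · 2^{(τ_F − 2)/3}` — the image under `F` of the laser-point packings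
`⟨B⟩ ⊗ ⟨m,m,m⟩ ≤ cw₂^{⊠N}`, `B m² ≈ 3^N`, `m ≈ 2^{N/3}` (`PerfectAtLaser`, closed in the tree).
The g10 cut of record `ω = 2 ⟺ LaserTangency ∧ LaserMergeOptimal` is TRANSPORTED to `Δ(ℂ)`:

* `LaserFloorStrict`   (= LT_χ):  points with `τ_F ≥ 2 + η` lie UNIFORMLY STRICTLY above the floor;
* `LaserFloorAttained` (= BOTTOM_χ): the chord of slope `ℓ(ω)/2 = 1/3 + (log₂3 − 2/3)/ω` through the
  origin of the `(τ, log₂ F(cw₂))`-plane is (asymptotically) touched by `Δ(ℂ)`.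

Edges proved below (all sorry-free):
* `laserFloor`                         — the floor itself (from `PerfectAtLaser`); route item
  `LaserFloor` (33322) by `laserFloor_holds`;
* (paper corollary, not restated: the floor at the top point gives the quantitative door
  `ω ≤ 2 + 3 log₂(R̃(cw₂)/3)`; its `R̃(cw₂) ≤ 3 ⟹ ω = 2` instance is the landed
  `Theorems.matrixMultiplication_of_asymptoticRank_cwTensor_two_le_three`, lens 6);
* `strict_of_laserTangency`            — `LaserTangency → LaserFloorStrict` (apply `F` to a capped
  cell; the cap pays the premium);
* `laserMergeOptimal_of_attained`      — `LaserFloorAttained → LaserMergeOptimal` (apply `F` to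
  `⟨m,m,m⟩ ≤ cw₂^{⊠N}`);
* `summit_of_laserFloor`               — `LaserFloorStrict → LaserFloorAttained → ω = 2`;
* `attained_of_summit`, `strict_of_summit`, `summit_iff_laserFloor` — both pieces are NECESSARY,
  so the transported cut is again exact: `ω = 2 ⟺ LaserFloorStrict ∧ LaserFloorAttained`;
* §9 `tightAtTop_of_attained`, `attained_of_tightAtTop` — the ω-FREE LETTER of attainment,
  `LaserTightAtTop` («some δ-maximal point on ⟨2,2,2⟩ is δ-laser-tight»; `ω` enters only as
  `max_G τ_G`, `exists_top_point`) is equivalent to the chord form; `summit_iff_laserFloor'`: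
  `ω = 2 ⟺ LaserFloorStrict ∧ LaserTightAtTop` = route item `SummitIffLaserFloor` (33325) by
  `summitIffLaserFloor_holds`; route item `LaserFloorTransport` (33326) =
  `(LaserTangency → LaserFloorStrict) ∧ (LaserTightAtTop → LaserMergeOptimal)` by
  `laserFloorTransport_holds`.

Geometry (paper gloss): in the plane `(τ, x) = (log₂F⟨2,2,2⟩, log₂F(cw₂))` the pair-spectrum
`X = {(τ_F, x_F)}` lies on/above the floor line, contains the gauge corner `(2, log₂3)` (flattening)
and meets the top edge `τ = ω` (duality with attainment); `ω = 2` iff `X` meets the floor only at the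
gauge corner (Strict) while its top edge contains a floor point (TightAtTop).
Census coordinates: every universal spectral point of `ℂ` known in print (gauge points, support and
quantum functionals) sits at `(τ_F, F(cw₂)) = (2, 3) = (2, Λ(2))` — ON the floor at its left end.

Sources: Strassen1988 (asymptotic spectrum, duality), ChristandlVranaZuiddam2023 (Prop. 1.6,
quantum functionals), AlmanLi2026 (Prop. 4.1/4.2: the matmul spectrum), CoppersmithWinograd1990 (§6,
the `q = 2` laser bound), BurgisserClausenShokrollahi1997 (15.3, 15.41), Blaser2013 (§5).
-/

set_option linter.dupNamespace false

namespace Summit.MatrixMultiplication.MatrixMultiplication.Theorems.OutsiderSandwichLaserFloor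

open scoped BigOperators Topology
open Filter
open Literature.Computability.AlgebraicComplexity
open Literature.Barriers.MatrixMultiplication (logb_two_mul_log_le_log IsAdequate)
open Summit.MatrixMultiplication.MatrixMultiplication.Theses.OutsiderSandwich (PerfectAtLaser)
open Summit.MatrixMultiplication.MatrixMultiplication.Theorems.OutsiderSandwichPackingProfileLaser
  (perfectAtLaser_holds)

/-! ## 1. The matrix exponent `τ_F = log₂ F(⟨2,2,2⟩)` of a universal spectral point

(Self-contained: the power law `F(⟨m,m,m⟩) ≥ m^{τ_F}` is the tree's lower half
`logb_two_mul_log_le_log` applied to the monotone multiplicative family `m ↦ F(⟨m,m,m⟩)` of the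
adequate map `F` (CLLZ footnote 3, `IsUniversalSpectralPoint.isAdequate`); `2 ≤ τ_F` is Behrend's
`⟨n,n,n⟩ ≥ ⟨n^{2−o(1)}⟩` (`exists_tensorMonRestrictsTo_matMulTensor_unitTensor`) at `n = 2^k`;
`τ_F ≤ ω` is Strassen duality `F(⟨2,2,2⟩) ≤ R̃(⟨2,2,2⟩) = 2^ω`.) -/

variable {F : SpectralMap ℂ}

/-- A universal spectral point of `ℂ` is an adequate map (Strassen duality is proved in the tree). -/
theorem isAdequate_of_universal (hF : IsUniversalSpectralPoint ℂ F) : IsAdequate ℂ F :=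
  hF.isAdequate (strassen_duality_asymptoticRank_holds ℂ)

/-- `F(⟨1,1,1⟩) = 1`. -/
theorem map_matMulTensor_one (hF : IsUniversalSpectralPoint ℂ F) : F (matMulTensor ℂ 1 1 1) = 1 :=
  (isAdequate_of_universal hF).map_matMul_one (T := unitTensor ℂ 1)
    (by rw [hF.map_unitTensor_one]; norm_num)

/-- `1 ≤ F(⟨m,m,m⟩)` for `m ≥ 1`. -/
theorem one_le_map_matMulTensor (hF : IsUniversalSpectralPoint ℂ F) {m : ℕ} (hm : 1 ≤ m) :
    1 ≤ F (matMulTensor ℂ m m m) :=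
  (isAdequate_of_universal hF).one_le_map_matMul (map_matMulTensor_one hF) hm hm hm

/-- `F(⟨2^k,2^k,2^k⟩) = F(⟨2,2,2⟩)^k` (MaMu-multiplicativity). -/
theorem map_matMulTensor_two_pow (hF : IsUniversalSpectralPoint ℂ F) (k : ℕ) :
    F (matMulTensor ℂ (2 ^ k) (2 ^ k) (2 ^ k)) = F (matMulTensor ℂ 2 2 2) ^ k := by
  have hA := isAdequate_of_universal hF
  induction k with
  | zero => simp only [pow_zero]; exact map_matMulTensor_one hF
  | succ k ih =>
    have hk : 1 ≤ 2 ^ k := Nat.one_le_two_pow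
    rw [pow_succ, hA.mamu (2 ^ k) 2 (2 ^ k) 2 (2 ^ k) 2 hk (by norm_num) hk (by norm_num) hk
      (by norm_num), ih, pow_succ]

/-- **Power law, lower half**: `m^{τ_F} ≤ F(⟨m,m,m⟩)` for `m ≥ 1`. -/
theorem rpow_matExp_le_map_matMulTensor (hF : IsUniversalSpectralPoint ℂ F) {m : ℕ} (hm : 1 ≤ m) :
    (m : ℝ) ^ Real.logb 2 (F (matMulTensor ℂ 2 2 2)) ≤ F (matMulTensor ℂ m m m) := by
  have hA := isAdequate_of_universal hF
  have h1 := map_matMulTensor_one hF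
  have hmono : ∀ ⦃a b : ℕ⦄, 1 ≤ a → a ≤ b →
      (fun a => F (matMulTensor ℂ a a a)) a ≤ (fun a => F (matMulTensor ℂ a a a)) b :=
    fun a b _ hab => hA.map_matMul_mono hab hab hab
  have hmul : ∀ a b : ℕ, 1 ≤ a → 1 ≤ b →
      (fun a => F (matMulTensor ℂ a a a)) (a * b) =
        (fun a => F (matMulTensor ℂ a a a)) a * (fun a => F (matMulTensor ℂ a a a)) b :=
    fun a b ha hb => hA.mamu a b a b a b ha hb ha hb ha hb
  have hlog := logb_two_mul_log_le_log (g := fun a => F (matMulTensor ℂ a a a)) h1 hmono hmul hm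
  have hm0 : (0 : ℝ) < m := by exact_mod_cast hm
  have hg0 : 0 < F (matMulTensor ℂ m m m) := lt_of_lt_of_le one_pos (one_le_map_matMulTensor hF hm)
  rw [Real.rpow_def_of_pos hm0, ← Real.exp_log hg0, Real.exp_le_exp, mul_comm]
  exact hlog

/-- `2 ≤ τ_F` (Behrend: `⟨n,n,n⟩ ≥ ⟨R⟩` with `R ≥ n^{2−ε}`, at `n = 2^k`, and
`F(⟨2^k,2^k,2^k⟩) = F(⟨2,2,2⟩)^k = 2^{kτ_F}`). -/
theorem two_le_matExp (hF : IsUniversalSpectralPoint ℂ F) :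
    2 ≤ Real.logb 2 (F (matMulTensor ℂ 2 2 2)) := by
  set τ := Real.logb 2 (F (matMulTensor ℂ 2 2 2)) with hτ
  have hg0 : 0 < F (matMulTensor ℂ 2 2 2) :=
    lt_of_lt_of_le one_pos (one_le_map_matMulTensor hF (by norm_num))
  have hg2 : F (matMulTensor ℂ 2 2 2) = (2 : ℝ) ^ τ := (Real.rpow_logb two_pos (by norm_num) hg0).symm
  have hε : ∀ ε : ℝ, 0 < ε → ε ≤ 1 → 2 - ε ≤ τ := by
    intro ε hε hε1
    obtain ⟨n₀, hn₀⟩ := exists_tensorMonRestrictsTo_matMulTensor_unitTensor ℂ hε hε1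
    set k := n₀ + 1 with hk
    have hkn : n₀ ≤ 2 ^ k := by
      have h1 : n₀ < 2 ^ n₀ := n₀.lt_two_pow_self
      have h2 : 2 ^ n₀ ≤ 2 ^ k := Nat.pow_le_pow_right (by norm_num) (Nat.le_succ n₀)
      omega
    obtain ⟨R, hR, hres⟩ := hn₀ (2 ^ k) hkn
    have h1 : (R : ℝ) ≤ F (matMulTensor ℂ (2 ^ k) (2 ^ k) (2 ^ k)) := by
      rw [← hF.map_unitTensor R]
      exact hF.mono _ _ hres.tensorRestrictsTo
    rw [map_matMulTensor_two_pow hF k, hg2,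
      ← Real.rpow_mul_natCast (by norm_num : (0 : ℝ) ≤ 2) τ k] at h1
    have h2 : (((2 ^ k : ℕ) : ℝ)) ^ (2 - ε) = (2 : ℝ) ^ ((k : ℝ) * (2 - ε)) := by
      push_cast
      exact (Real.rpow_natCast_mul (by norm_num : (0 : ℝ) ≤ 2) k (2 - ε)).symm
    rw [h2] at hR
    have h3 : (k : ℝ) * (2 - ε) ≤ τ * k := (Real.rpow_le_rpow_left_iff one_lt_two).1 (hR.trans h1)
    have hk0 : (0 : ℝ) < k := by positivity
    exact le_of_mul_le_mul_right (by linarith [h3] : (2 - ε) * (k : ℝ) ≤ τ * k) hk0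
  refine le_of_forall_pos_lt_add fun δ hδ => ?_
  have h := hε (min δ 1 / 2) (by positivity) (by
    have := min_le_right δ 1
    linarith)
  have : min δ 1 / 2 < δ := by
    have := min_le_left δ 1
    linarith [lt_min hδ one_pos]
  linarith

/-- Applying a universal spectral point to a packing `⟨B⟩ ⊗ ⟨m,m,m⟩ ≤ cw₂^{⊠N}`:
`B · m^{τ_F} ≤ F(cw₂)^N`. -/
theorem mul_rpow_le_pow_of_packing (hF : IsUniversalSpectralPoint ℂ F) {N B m : ℕ} (hm : 1 ≤ m)
    (hres : TensorRestrictsTo (kroneckerPow (cwTensor ℂ 2) N)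
      (kroneckerTensor (unitTensor ℂ B) (matMulTensor ℂ m m m))) :
    (B : ℝ) * (m : ℝ) ^ Real.logb 2 (F (matMulTensor ℂ 2 2 2)) ≤ F (cwTensor ℂ 2) ^ N := by
  have h := hF.mono _ _ hres
  rw [hF.map_kronecker, hF.map_unitTensor, hF.map_kroneckerPow] at h
  exact le_trans (mul_le_mul_of_nonneg_left (rpow_matExp_le_map_matMulTensor hF hm)
    (Nat.cast_nonneg B)) h

/-! ## 2. The laser floor `F(cw₂) ≥ 3 · 2^{(τ_F − 2)/3}` (ω-free, from `PerfectAtLaser`) -/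

/-- **Laser floor, multiplicative form.**  For every universal spectral point `F` of `ℂ`:
`3 · 2^{(τ_F − 2)/3} ≤ F(cw₂)`.  Proof: apply `F` to the laser-point packings of `PerfectAtLaser`
(`B m² ≥ 3^{(1−ε)N}`, `m ≥ 2^{N/3}`): `F(cw₂)^N ≥ B m^{τ_F} ≥ 3^{(1−ε)N} 2^{(N/3)(τ_F−2)}`, take
`N`-th roots and let `ε → 0`. -/
theorem laserFloor_mul (hF : IsUniversalSpectralPoint ℂ F) :
    3 * (2 : ℝ) ^ ((Real.logb 2 (F (matMulTensor ℂ 2 2 2)) - 2) / 3) ≤ F (cwTensor ℂ 2) := by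
  set τ := Real.logb 2 (F (matMulTensor ℂ 2 2 2)) with hτ
  have hτ2 : 2 ≤ τ := two_le_matExp hF
  have hF0 : 0 ≤ F (cwTensor ℂ 2) := hF.nonneg _
  have hC0 : 0 < (2 : ℝ) ^ ((τ - 2) / 3) := Real.rpow_pos_of_pos two_pos _
  have key : ∀ ε : ℝ, 0 < ε → ε < 1 →
      (3 : ℝ) ^ (1 - ε) * (2 : ℝ) ^ ((τ - 2) / 3) ≤ F (cwTensor ℂ 2) := by
    intro ε hε hε1
    obtain ⟨N, hN, B, m, hres, hcell, hm⟩ := perfectAtLaser_holds ε hε 1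
    have hm0 : (0 : ℝ) < m := lt_of_lt_of_le (Real.rpow_pos_of_pos two_pos _) hm
    have hm1 : 1 ≤ m := by
      rcases Nat.eq_zero_or_pos m with h | h
      · exfalso; rw [h] at hm0; simp at hm0
      · exact h
    have hP := mul_rpow_le_pow_of_packing hF hm1 hres
    have hsplit : (m : ℝ) ^ τ = (m : ℝ) ^ 2 * (m : ℝ) ^ (τ - 2) := by
      rw [← Real.rpow_natCast (m : ℝ) 2, ← Real.rpow_add hm0]
      congr 1; push_cast; ring
    -- `3^{(1-ε)N} (2^{N/3})^{τ-2} ≤ B m^τ`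
    have h1 : (3 : ℝ) ^ ((1 - ε) * N) * ((2 : ℝ) ^ ((N : ℝ) / 3)) ^ (τ - 2) ≤
        (B : ℝ) * (m : ℝ) ^ τ := by
      rw [hsplit, ← mul_assoc]
      exact mul_le_mul hcell (Real.rpow_le_rpow (by positivity) hm (by linarith))
        (by positivity) (by positivity)
    have e3 : (3 : ℝ) ^ ((1 - ε) * N) = ((3 : ℝ) ^ (1 - ε)) ^ N :=
      Real.rpow_mul_natCast (by norm_num) _ _
    have e2 : ((2 : ℝ) ^ ((N : ℝ) / 3)) ^ (τ - 2) = ((2 : ℝ) ^ ((τ - 2) / 3)) ^ N := by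
      rw [← Real.rpow_mul (by norm_num), ← Real.rpow_mul_natCast (by norm_num)]
      congr 1; ring
    rw [e3, e2, ← mul_pow] at h1
    have h2 : ((3 : ℝ) ^ (1 - ε) * (2 : ℝ) ^ ((τ - 2) / 3)) ^ N ≤ F (cwTensor ℂ 2) ^ N :=
      h1.trans hP
    exact le_of_pow_le_pow_left₀ (by omega) hF0 h2
  -- `ε → 0⁺`
  have hlim : Tendsto (fun ε : ℝ => (3 : ℝ) ^ (1 - ε) * (2 : ℝ) ^ ((τ - 2) / 3)) (𝓝[>] 0)
      (𝓝 ((3 : ℝ) ^ (1 - (0 : ℝ)) * (2 : ℝ) ^ ((τ - 2) / 3))) := by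
    have hc : ContinuousAt (fun x : ℝ => (3 : ℝ) ^ x) (1 - 0) :=
      Real.continuousAt_const_rpow (by norm_num)
    have ht : Tendsto (fun ε : ℝ => 1 - ε) (𝓝[>] 0) (𝓝 (1 - 0)) :=
      (tendsto_const_nhds.sub tendsto_id).mono_left nhdsWithin_le_nhds
    exact (hc.tendsto.comp ht).mul_const _
  rw [sub_zero, Real.rpow_one] at hlim
  refine le_of_tendsto hlim ?_
  filter_upwards [Ioo_mem_nhdsGT (zero_lt_one' ℝ)] with ε hε using key ε hε.1 hε.2

/-- **Laser floor** (logarithmic form; the route item `LaserFloor`):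
`log₂ 3 + (τ_F − 2)/3 ≤ log₂ F(cw₂)` for every universal spectral point `F` of `ℂ`. -/
theorem laserFloor (hF : IsUniversalSpectralPoint ℂ F) :
    Real.logb 2 3 + (Real.logb 2 (F (matMulTensor ℂ 2 2 2)) - 2) / 3 ≤
      Real.logb 2 (F (cwTensor ℂ 2)) := by
  have h := laserFloor_mul hF
  have hC0 : 0 < (2 : ℝ) ^ ((Real.logb 2 (F (matMulTensor ℂ 2 2 2)) - 2) / 3) :=
    Real.rpow_pos_of_pos two_pos _
  calc Real.logb 2 3 + (Real.logb 2 (F (matMulTensor ℂ 2 2 2)) - 2) / 3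
      = Real.logb 2 (3 * (2 : ℝ) ^ ((Real.logb 2 (F (matMulTensor ℂ 2 2 2)) - 2) / 3)) := by
        rw [Real.logb_mul (by norm_num) hC0.ne', Real.logb_rpow two_pos (by norm_num)]
    _ ≤ Real.logb 2 (F (cwTensor ℂ 2)) :=
        Real.logb_le_logb_of_le one_lt_two (by positivity) h

/-- The laser floor, universally quantified (exactly the route item `LaserFloor`). -/
theorem laserFloor_all : ∀ F : SpectralMap ℂ, IsUniversalSpectralPoint ℂ F →
    Real.logb 2 3 + (Real.logb 2 (F (matMulTensor ℂ 2 2 2)) - 2) / 3 ≤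
      Real.logb 2 (F (cwTensor ℂ 2)) :=
  fun _ hF => laserFloor hF

/-! ## Route item `LaserFloor` (33322) by name -/

/-- Item `LaserFloor` (stmt-MatrixMultiplication-33322) holds. -/
theorem laserFloor_holds :
    Summit.MatrixMultiplication.MatrixMultiplication.Theses.OutsiderSandwich.LaserFloor :=
  laserFloor_all

end Summit.MatrixMultiplication.MatrixMultiplication.Theorems.OutsiderSandwichLaserFloor
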